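import Summits.RiemannHypothesis.RiemannHypothesis.Theorems.Splittings.LiIncrHighPartSplit
import HarnessLib

/-!
# The increment weight: window identity, pointwise bounds, `S`-terms, `ϑ'`/`θ_t` replacements (RH-free; SketchG6C §§4–7)

Cell rh-split, seat rh-split-li-bridge g6 (brief sha16 f79c5f09d8bcb036), card `run/shared/lean/pub/rh-split/cards/SPLIT-li-bridge.md` §13
(13.5 paper proof «SOUND ON PAPER», referee rh-split-ref g3 06:17:36Z; 13.17); kernel source `HOME/rh-split-li-bridge/SketchG6T.lean` sha16
911a043700f05677 (2287 l; = SketchG6B [γ] ++ SketchG6C [α][β] ++ Part D [δ] ++ Part T, re-pointed at the tree's `LiIncrMeanSquare` /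
`LiIncrBlockLaw`, p508264 / p508611).  Filed by rh-split-typer-2 g4 (lane (xi)(c)–(f)) as a chain of ten tree modules cut at the scratch's
section boundaries, decl text byte-verbatim; deltas = namespaces `RhSplit.LiBridgeG6B/C/D/T` ↦
`…Theorems.Splittings.{LiLowZeroBudget, LiIncrHighPart, LiIncrBlockLawOfRH}` (qualified cross-references rewritten), module docstrings, and
one-line docstrings added where the scratch had none.  END-TO-END statement of the chain (last file):
`LiIncrBlockLawOfRH.rh_iff_almostAllLiMonotone : RiemannHypothesis ↔ ∃ E ⊆ ℕ of natural density zero, ∀ n ≥ 1, n ∉ E → λ_n ≤ λ_{n+1}`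
— T-Li3 IN KERNEL, a RELABELLING of RH (RH-EQUIVALENT, PROVED; certifies nothing about RH; class (li, bridge) unchanged).

This file: §4 the window identity for the increment weight, §5 pointwise bounds, §6 the `S`-terms (boundary `≤ 1`, Backlund integral), §7 replacing `ϑ'` by
`½ log(t/2π)` and `θ_t` by `1/t`.

Gate dedup: `log_le_self_of_pos` is `private` here (it restates the landed `Literature.NumberTheory.Transcendental.log_le_self_of_pos`);
its one downstream use (in `LiIncrHighPart.lean`) is inlined there.

HONEST LABEL: «SPLITTING SEARCH over kernel-typed RH-EQUIVALENCES; a splitting A ∧ B ⟹ RH is CONDITIONAL bookkeeping unless A and B are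
both proved; nothing here bears on the truth of RH.»
-/

set_option linter.dupNamespace false

noncomputable section

namespace Summit.RiemannHypothesis.RiemannHypothesis.Theorems.Splittings.LiIncrHighPart

open Filter Topology Finset Set MeasureTheory
open scoped Real
open Literature.NumberTheory.LFunctions Literature.NumberTheory.LFunctions.SchoenfeldBound
open Literature.NumberTheory.DiophantineGeometry
open Summit.RiemannHypothesis.RiemannHypothesis.Theorems.LiTheory
open Summit.RiemannHypothesis.RiemannHypothesis.Theorems.LiTheory.SmoothReplace
open Summit.RiemannHypothesis.RiemannHypothesis.Theorems.LiTheory.Window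

/-! ## §4 The window identity for the increment weight (RH-free; start of stub [β]) -/

/-- **RH-free.** `Σ_{Y<γ≤T'} m w_n(γ) = (1/π)∫_Y^{T'} w_n ϑ' + S(T') w_n(T') − S(Y) w_n(Y) − ∫_Y^{T'} S w_n'`
for `0 < Y ≤ T'`. -/
theorem incr_windowIdentity (n : ℕ) {Y T' : ℝ} (hY : 0 < Y) (hYT : Y ≤ T') :
    ∑ ρ ∈ zerosBetween Y T', mult ρ * incrWeight n ρ.im =
      1 / Real.pi * (∫ t in Y..T', incrWeight n t * riemannSiegelThetaDeriv t)
        + zetaArgS T' * incrWeight n T' - zetaArgS Y * incrWeight n Y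
        - ∫ t in Y..T', zetaArgS t * incrWeightDeriv n t := by
  unfold mult
  exact Window.windowIdentity hY.le hYT
    (fun t ht ↦ hasDerivAt_incrWeight n (by linarith [ht.1] : t ≠ 0))
    (continuousOn_incrWeightDeriv n hY)

/-- Hence, under RH, the high part is the limit of the window-identity right-hand sides. -/
theorem tendsto_windowRHS_highPart (hRH : RiemannHypothesis) {n : ℕ} (hn : 1 ≤ n) {Y : ℝ}
    (hY : 0 < Y) :
    Tendsto (fun T' : ℝ ↦
      1 / Real.pi * (∫ t in Y..T', incrWeight n t * riemannSiegelThetaDeriv t)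
        + zetaArgS T' * incrWeight n T' - zetaArgS Y * incrWeight n Y
        - ∫ t in Y..T', zetaArgS t * incrWeightDeriv n t) atTop (𝓝 (highPart n Y)) := by
  refine (incr_decomposition hRH hn hY.le).congr' ?_
  filter_upwards [eventually_ge_atTop Y] with T' hT'
  exact incr_windowIdentity n hY hT'

/-- **Lower-bound transfer.**  If the window right-hand sides are eventually `≥ B`, then `P_Y(n) ≥ B`:
the form in which stub [β] (`P(n) ≥ c·log N` on `n ∈ [N, 2N)`, card §13.5) feeds the block law. -/
theorem highPart_ge_of_eventually (hRH : RiemannHypothesis) {n : ℕ} (hn : 1 ≤ n) {Y B : ℝ}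
    (hY : 0 < Y)
    (hB : ∀ᶠ T' : ℝ in atTop,
      B ≤ 1 / Real.pi * (∫ t in Y..T', incrWeight n t * riemannSiegelThetaDeriv t)
        + zetaArgS T' * incrWeight n T' - zetaArgS Y * incrWeight n Y
        - ∫ t in Y..T', zetaArgS t * incrWeightDeriv n t) :
    B ≤ highPart n Y :=
  ge_of_tendsto (tendsto_windowRHS_highPart hRH hn hY) hB


/-! ## §5 Pointwise bounds for the increment weight (RH-free) -/

/-- `|w_n(t)| ≤ 2 θ_t ≤ 2/t` (`|cos a − cos b| ≤ |a − b|`). -/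
theorem abs_incrWeight_le (n : ℕ) {t : ℝ} (ht : 0 < t) : |incrWeight n t| ≤ 2 / t := by
  obtain ⟨h0, h1⟩ := liZeroAngle_bounds ht
  have e : incrWeight n t =
      2 * (Real.cos (n * liZeroAngle t) - Real.cos (((n + 1 : ℕ) : ℝ) * liZeroAngle t)) := by
    unfold incrWeight liWindowWeight; ring
  have h := Real.abs_cos_sub_cos_le ((n : ℝ) * liZeroAngle t) (((n + 1 : ℕ) : ℝ) * liZeroAngle t)
  have e2 : (n : ℝ) * liZeroAngle t - ((n + 1 : ℕ) : ℝ) * liZeroAngle t = -liZeroAngle t := by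
    push_cast; ring
  rw [e2, abs_neg, abs_of_nonneg h0] at h
  rw [e, abs_mul, abs_two]
  calc 2 * |Real.cos (n * liZeroAngle t) - Real.cos (((n + 1 : ℕ) : ℝ) * liZeroAngle t)|
      ≤ 2 * (1 / t) := by linarith
    _ = 2 / t := by ring

/-- `|w_n'(t)| ≤ 2/t² + 2n/t³` (`|θ'| ≤ 1/t²`, `|(n+1) sin((n+1)θ) − n sin(nθ)| ≤ 1 + nθ`). -/
theorem abs_incrWeightDeriv_le (n : ℕ) {t : ℝ} (ht : 0 < t) :
    |incrWeightDeriv n t| ≤ 2 / t ^ 2 + 2 * n / t ^ 3 := by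
  obtain ⟨h0, h1⟩ := liZeroAngle_bounds ht
  have hden : (0 : ℝ) < 4 * t ^ 2 + 1 := by positivity
  have e : incrWeightDeriv n t = 2 * (-4 / (4 * t ^ 2 + 1)) *
      (Real.sin (((n + 1 : ℕ) : ℝ) * liZeroAngle t) +
        n * (Real.sin (((n + 1 : ℕ) : ℝ) * liZeroAngle t) - Real.sin (n * liZeroAngle t))) := by
    unfold incrWeightDeriv liWindowWeightDeriv; push_cast; ring
  have hfrac : |(-4 : ℝ) / (4 * t ^ 2 + 1)| ≤ 1 / t ^ 2 := by
    rw [abs_div, abs_of_pos hden, show |(-4 : ℝ)| = 4 by norm_num,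
      div_le_div_iff₀ hden (by positivity)]
    nlinarith
  have hs1 := Real.abs_sin_le_one (((n + 1 : ℕ) : ℝ) * liZeroAngle t)
  have hs2 := Real.abs_sin_sub_sin_le (((n + 1 : ℕ) : ℝ) * liZeroAngle t) ((n : ℝ) * liZeroAngle t)
  have e2 : ((n + 1 : ℕ) : ℝ) * liZeroAngle t - n * liZeroAngle t = liZeroAngle t := by
    push_cast; ring
  rw [e2, abs_of_nonneg h0] at hs2
  have hn : (0 : ℝ) ≤ n := n.cast_nonneg
  have hB : |Real.sin (((n + 1 : ℕ) : ℝ) * liZeroAngle t) +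
      n * (Real.sin (((n + 1 : ℕ) : ℝ) * liZeroAngle t) - Real.sin (n * liZeroAngle t))| ≤
      1 + n * (1 / t) := by
    refine (abs_add_le _ _).trans ?_
    rw [abs_mul, Nat.abs_cast]
    have := mul_le_mul_of_nonneg_left (hs2.trans h1) hn
    linarith
  rw [e, abs_mul, abs_mul, abs_two]
  calc 2 * |(-4 : ℝ) / (4 * t ^ 2 + 1)| *
        |Real.sin (((n + 1 : ℕ) : ℝ) * liZeroAngle t) +
          n * (Real.sin (((n + 1 : ℕ) : ℝ) * liZeroAngle t) - Real.sin (n * liZeroAngle t))|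
      ≤ 2 * (1 / t ^ 2) * (1 + n * (1 / t)) :=
        mul_le_mul (mul_le_mul_of_nonneg_left hfrac (by norm_num)) hB (abs_nonneg _) (by positivity)
    _ = 2 / t ^ 2 + 2 * n / t ^ 3 := by field_simp

/-- The `1/t`-model of the increment weight: `w̃_n(t) := 2 (cos(n/t) − cos((n+1)/t))`. -/
def modelW (n : ℕ) (t : ℝ) : ℝ := 2 * (Real.cos (n / t) - Real.cos (((n : ℝ) + 1) / t))

/-- `|w_n(t) − w̃_n(t)| ≤ (2n+1)/(6t³)` (`|θ_t − 1/t| ≤ 1/(12t³)`). -/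
theorem abs_incrWeight_sub_modelW_le (n : ℕ) {t : ℝ} (ht : 0 < t) :
    |incrWeight n t - modelW n t| ≤ (2 * n + 1) / (6 * t ^ 3) := by
  have h1 := abs_liWindowWeight_sub_model_le (n + 1) ht
  have h0 := abs_liWindowWeight_sub_model_le n ht
  have e : incrWeight n t - modelW n t =
      2 * ((liWindowWeight (n + 1) t - (1 - Real.cos (((n + 1 : ℕ) : ℝ) / t))) -
        (liWindowWeight n t - (1 - Real.cos (n / t)))) := by
    unfold incrWeight modelW; push_cast; ring
  rw [e, abs_mul, abs_two]
  have h := abs_sub (liWindowWeight (n + 1) t - (1 - Real.cos (((n + 1 : ℕ) : ℝ) / t)))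
    (liWindowWeight n t - (1 - Real.cos (n / t)))
  have e2 : (((n + 1 : ℕ) : ℝ)) / (12 * t ^ 3) + n / (12 * t ^ 3) = (2 * n + 1) / (12 * t ^ 3) := by
    push_cast; ring
  calc 2 * |liWindowWeight (n + 1) t - (1 - Real.cos (((n + 1 : ℕ) : ℝ) / t)) -
        (liWindowWeight n t - (1 - Real.cos (n / t)))|
      ≤ 2 * ((2 * n + 1) / (12 * t ^ 3)) := by rw [← e2]; linarith
    _ = (2 * n + 1) / (6 * t ^ 3) := by ring

/-! ## §6 The `S`-terms of the increment (RH-free): boundary terms `≤ 1`, Backlund integral -/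

/-- Auxiliary lemma `log_le_self_of_pos` of the increment-weight analysis [β] (li-bridge g6 `SketchG6T`; see the module docstring for its place in the argument). -/
private theorem log_le_self_of_pos {x : ℝ} (hx : 0 < x) : Real.log x ≤ x := by
  linarith [Real.log_le_sub_one_of_pos hx]

/-- Boundary term: `|S(t) w_n(t)| ≤ (0.3083 log t + 3.24)·2/t ≤ 1` for `t ≥ 30`. -/
theorem abs_S_mul_incrWeight_le (n : ℕ) {t : ℝ} (ht : 30 ≤ t) : |zetaArgS t * incrWeight n t| ≤ 1 := by
  have ht0 : 0 < t := by linarith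
  have hS := abs_zetaArgS_le_explicit ht
  have hw := abs_incrWeight_le n ht0
  have hlog := log_le_self_of_pos ht0
  have hlog0 : 0 ≤ Real.log t := Real.log_nonneg (by linarith)
  rw [abs_mul]
  calc |zetaArgS t| * |incrWeight n t| ≤ (0.3083 * Real.log t + 3.24) * (2 / t) :=
        mul_le_mul hS hw (abs_nonneg _) (by positivity)
    _ ≤ (0.3083 * t + 3.24) * (2 / t) := by gcongr
    _ = 0.6166 + 6.48 / t := by field_simp; ring
    _ ≤ 1 := by
        have : 6.48 / t ≤ 6.48 / 30 := div_le_div_of_nonneg_left (by norm_num) (by norm_num) ht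
        norm_num at this ⊢; linarith

/-- **Backlund integral for the increment (RH-free):**
`|∫_Y^{T'} S w_n'| ≤ 1 + n (0.3083 log Y + 3.4)/Y²` for `30 ≤ Y ≤ T'`
(`|S| ≤ 0.3083 log t + 3.24`, `|w_n'| ≤ 2/t² + 2n/t³`, exact antiderivative, the `T'`-end dropped). -/
theorem abs_integral_S_mul_incrWeightDeriv_le (n : ℕ) {Y T' : ℝ} (hY : 30 ≤ Y) (hYT : Y ≤ T') :
    |∫ t in Y..T', zetaArgS t * incrWeightDeriv n t| ≤
      1 + n * (0.3083 * Real.log Y + 3.4) / Y ^ 2 := by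
  have hY0 : 0 < Y := by linarith
  have hn : (0 : ℝ) ≤ n := n.cast_nonneg
  have hle : ∀ᵐ t ∂volume, t ∈ Ioc Y T' →
      ‖zetaArgS t * incrWeightDeriv n t‖ ≤
        (0.3083 * Real.log t + 3.24) * (2 / t ^ 2 + 2 * n / t ^ 3) :=
    Filter.Eventually.of_forall fun t ht ↦ by
      have ht30 : 30 ≤ t := by linarith [ht.1]
      have ht0 : 0 < t := by linarith
      rw [Real.norm_eq_abs, abs_mul]
      exact mul_le_mul (abs_zetaArgS_le_explicit ht30) (abs_incrWeightDeriv_le n ht0) (abs_nonneg _)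
        (by have := Real.log_nonneg (by linarith : (1 : ℝ) ≤ t); positivity)
  have hcont : ContinuousOn
      (fun t : ℝ ↦ (0.3083 * Real.log t + 3.24) * (2 / t ^ 2 + 2 * n / t ^ 3)) (uIcc Y T') := by
    refine continuousOn_of_forall_continuousAt fun t ht ↦ ?_
    rw [uIcc_of_le hYT] at ht
    have ht0 : t ≠ 0 := by linarith [ht.1]
    have ht2 : t ^ 2 ≠ 0 := pow_ne_zero 2 ht0
    have ht3 : t ^ 3 ≠ 0 := pow_ne_zero 3 ht0
    fun_prop (disch := assumption)
  have h := intervalIntegral.norm_integral_le_of_norm_le hYT hle hcont.intervalIntegrable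
  have hFTC : ∫ t in Y..T', (0.3083 * Real.log t + 3.24) * (2 / t ^ 2 + 2 * n / t ^ 3) =
      (2 * (0.3083 * (Real.log Y + 1) + 3.24) / Y
          + n * (0.3083 * (Real.log Y + 1 / 2) + 3.24) / Y ^ 2) -
        (2 * (0.3083 * (Real.log T' + 1) + 3.24) / T'
          + n * (0.3083 * (Real.log T' + 1 / 2) + 3.24) / T' ^ 2) := by
    have hderiv : ∀ t ∈ uIcc Y T', HasDerivAt
        (fun y : ℝ ↦ -(2 * (0.3083 * (Real.log y + 1) + 3.24) / y
          + n * (0.3083 * (Real.log y + 1 / 2) + 3.24) / y ^ 2))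
        ((0.3083 * Real.log t + 3.24) * (2 / t ^ 2 + 2 * n / t ^ 3)) t := by
      intro t ht
      rw [uIcc_of_le hYT] at ht
      have ht0 : t ≠ 0 := by linarith [ht.1]
      have hl := Real.hasDerivAt_log ht0
      have h1 : HasDerivAt (fun y : ℝ ↦ 2 * (0.3083 * (Real.log y + 1) + 3.24))
          (2 * (0.3083 * t⁻¹)) t := by
        simpa using (((hl.add_const 1).const_mul (0.3083 : ℝ)).add_const (3.24 : ℝ)).const_mul (2 : ℝ)
      have h2 : HasDerivAt (fun y : ℝ ↦ (n : ℝ) * (0.3083 * (Real.log y + 1 / 2) + 3.24))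
          (n * (0.3083 * t⁻¹)) t := by
        simpa using
          (((hl.add_const (1 / 2 : ℝ)).const_mul (0.3083 : ℝ)).add_const (3.24 : ℝ)).const_mul (n : ℝ)
      have h3 : HasDerivAt (fun y : ℝ ↦ y ^ 2) (2 * t) t := by simpa using hasDerivAt_pow 2 t
      have h := ((h1.div (hasDerivAt_id t) ht0).add (h2.div h3 (pow_ne_zero 2 ht0))).neg
      refine h.congr_deriv ?_
      simp only [id]
      field_simp
      ring
    rw [intervalIntegral.integral_eq_sub_of_hasDerivAt hderiv hcont.intervalIntegrable]
    ring
  rw [hFTC, Real.norm_eq_abs] at h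
  have hT0 : 0 < T' := by linarith
  have hlogT : 0 ≤ Real.log T' := Real.log_nonneg (by linarith)
  have hdrop : 0 ≤ 2 * (0.3083 * (Real.log T' + 1) + 3.24) / T'
      + n * (0.3083 * (Real.log T' + 1 / 2) + 3.24) / T' ^ 2 := by positivity
  have hlogY : Real.log Y ≤ Y := log_le_self_of_pos hY0
  have hlogY0 : 0 ≤ Real.log Y := Real.log_nonneg (by linarith)
  have h1 : 2 * (0.3083 * (Real.log Y + 1) + 3.24) / Y ≤ 1 := by
    rw [div_le_one hY0]; nlinarith
  have h2 : n * (0.3083 * (Real.log Y + 1 / 2) + 3.24) / Y ^ 2 ≤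
      n * (0.3083 * Real.log Y + 3.4) / Y ^ 2 := by
    apply div_le_div_of_nonneg_right _ (by positivity)
    apply mul_le_mul_of_nonneg_left _ hn
    norm_num
    linarith
  linarith

/-! ## §7 Replacing `ϑ'` by `½ log(t/2π)` and `θ_t` by `1/t` (RH-free) -/

/-- `|∫_Y^{T'} w_n (ϑ' − ½ log(t/2π))| ≤ 4/Y` for `1 ≤ Y ≤ T'` (`|w_n| ≤ 2/t`, `|ϑ' − ½ log(t/2π)| ≤ 2/t`). -/
theorem abs_integral_thetaErr_le (n : ℕ) {Y T' : ℝ} (hY : 1 ≤ Y) (hYT : Y ≤ T') :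
    |∫ t in Y..T', incrWeight n t * (riemannSiegelThetaDeriv t - Real.log (t / (2 * π)) / 2)| ≤
      4 / Y := by
  have hY0 : 0 < Y := by linarith
  have hle : ∀ᵐ t ∂volume, t ∈ Ioc Y T' →
      ‖incrWeight n t * (riemannSiegelThetaDeriv t - Real.log (t / (2 * π)) / 2)‖ ≤ 4 / t ^ 2 :=
    Filter.Eventually.of_forall fun t ht ↦ by
      have ht1 : 1 ≤ t := by linarith [ht.1]
      have ht0 : 0 < t := by linarith
      rw [Real.norm_eq_abs, abs_mul]
      calc |incrWeight n t| * |riemannSiegelThetaDeriv t - Real.log (t / (2 * π)) / 2|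
          ≤ (2 / t) * (2 / t) :=
            mul_le_mul (abs_incrWeight_le n ht0) (abs_riemannSiegelThetaDeriv_sub_log_le ht1)
              (abs_nonneg _) (by positivity)
        _ = 4 / t ^ 2 := by field_simp; ring
  have hcont : ContinuousOn (fun t : ℝ ↦ 4 / t ^ 2) (uIcc Y T') := by
    refine continuousOn_of_forall_continuousAt fun t ht ↦ ?_
    rw [uIcc_of_le hYT] at ht
    have ht0 : t ≠ 0 := by linarith [ht.1]
    have ht2 : t ^ 2 ≠ 0 := pow_ne_zero 2 ht0
    fun_prop (disch := assumption)
  have h := intervalIntegral.norm_integral_le_of_norm_le hYT hle hcont.intervalIntegrable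
  have hFTC : ∫ t in Y..T', 4 / t ^ 2 = 4 / Y - 4 / T' := by
    have hderiv : ∀ t ∈ uIcc Y T', HasDerivAt (fun y : ℝ ↦ -4 / y) (4 / t ^ 2) t := by
      intro t ht
      rw [uIcc_of_le hYT] at ht
      have ht0 : t ≠ 0 := by linarith [ht.1]
      have h := (hasDerivAt_const t (-4 : ℝ)).div (hasDerivAt_id t) ht0
      refine h.congr_deriv ?_
      simp only [id]
      field_simp
      ring
    rw [intervalIntegral.integral_eq_sub_of_hasDerivAt hderiv hcont.intervalIntegrable]
    ring
  rw [hFTC, Real.norm_eq_abs] at h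
  have hT0 : 0 < T' := by linarith
  have : 0 ≤ 4 / T' := by positivity
  linarith

/-- `|∫_Y^{T'} (w_n − w̃_n) · ½ log(t/2π)| ≤ (2n+1)(2 log Y + 1)/(48 Y²)` for `2π ≤ Y ≤ T'`. -/
theorem abs_integral_modelErr_le (n : ℕ) {Y T' : ℝ} (hY : 2 * π ≤ Y) (hYT : Y ≤ T') :
    |∫ t in Y..T', (incrWeight n t - modelW n t) * (Real.log (t / (2 * π)) / 2)| ≤
      (2 * n + 1) * (2 * Real.log Y + 1) / (48 * Y ^ 2) := by
  have hπ := Real.pi_pos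
  have hπ3 := Real.pi_gt_three
  have hY0 : 0 < Y := by linarith
  have hn : (0 : ℝ) ≤ n := n.cast_nonneg
  have hle : ∀ᵐ t ∂volume, t ∈ Ioc Y T' →
      ‖(incrWeight n t - modelW n t) * (Real.log (t / (2 * π)) / 2)‖ ≤
        (2 * n + 1) * Real.log t / (12 * t ^ 3) :=
    Filter.Eventually.of_forall fun t ht ↦ by
      have ht2π : 2 * π ≤ t := by linarith [ht.1]
      have ht0 : 0 < t := by linarith
      have hlog2π : 0 ≤ Real.log (2 * π) := Real.log_nonneg (by linarith)
      have hL : Real.log (t / (2 * π)) = Real.log t - Real.log (2 * π) :=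
        Real.log_div ht0.ne' (by positivity)
      have hL0 : 0 ≤ Real.log (t / (2 * π)) :=
        Real.log_nonneg (by rw [le_div_iff₀ (by positivity)]; linarith)
      rw [Real.norm_eq_abs, abs_mul, abs_of_nonneg (by positivity : 0 ≤ Real.log (t / (2 * π)) / 2)]
      calc |incrWeight n t - modelW n t| * (Real.log (t / (2 * π)) / 2)
          ≤ (2 * n + 1) / (6 * t ^ 3) * (Real.log t / 2) :=
            mul_le_mul (abs_incrWeight_sub_modelW_le n ht0) (by rw [hL]; linarith) (by positivity)
              (by positivity)
        _ = (2 * n + 1) * Real.log t / (12 * t ^ 3) := by field_simp; ring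
  have hcont : ContinuousOn (fun t : ℝ ↦ (2 * n + 1) * Real.log t / (12 * t ^ 3)) (uIcc Y T') := by
    refine continuousOn_of_forall_continuousAt fun t ht ↦ ?_
    rw [uIcc_of_le hYT] at ht
    have ht0 : t ≠ 0 := by linarith [ht.1]
    have ht3 : 12 * t ^ 3 ≠ 0 := by positivity
    fun_prop (disch := assumption)
  have h := intervalIntegral.norm_integral_le_of_norm_le hYT hle hcont.intervalIntegrable
  have hFTC : ∫ t in Y..T', (2 * n + 1) * Real.log t / (12 * t ^ 3) =
      (2 * n + 1) * (2 * Real.log Y + 1) / (48 * Y ^ 2)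
        - (2 * n + 1) * (2 * Real.log T' + 1) / (48 * T' ^ 2) := by
    have hderiv : ∀ t ∈ uIcc Y T', HasDerivAt
        (fun y : ℝ ↦ -((2 * n + 1) * (2 * Real.log y + 1) / (48 * y ^ 2)))
        ((2 * n + 1) * Real.log t / (12 * t ^ 3)) t := by
      intro t ht
      rw [uIcc_of_le hYT] at ht
      have ht0 : t ≠ 0 := by linarith [ht.1]
      have hl := Real.hasDerivAt_log ht0
      have h1 : HasDerivAt (fun y : ℝ ↦ (2 * n + 1) * (2 * Real.log y + 1))
          ((2 * n + 1) * (2 * t⁻¹)) t := by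
        simpa using ((hl.const_mul (2 : ℝ)).add_const (1 : ℝ)).const_mul (2 * n + 1 : ℝ)
      have h3 : HasDerivAt (fun y : ℝ ↦ 48 * y ^ 2) (48 * (2 * t)) t := by
        simpa using (hasDerivAt_pow 2 t).const_mul (48 : ℝ)
      have h := (h1.div h3 (by positivity)).neg
      refine h.congr_deriv ?_
      field_simp
      ring
    rw [intervalIntegral.integral_eq_sub_of_hasDerivAt hderiv hcont.intervalIntegrable]
    ring
  rw [hFTC, Real.norm_eq_abs] at h
  have hT0 : 0 < T' := by linarith
  have hlogT : 0 ≤ Real.log T' := Real.log_nonneg (by linarith)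
  have hdrop : 0 ≤ (2 * n + 1) * (2 * Real.log T' + 1) / (48 * T' ^ 2) := by positivity
  linarith

end Summit.RiemannHypothesis.RiemannHypothesis.Theorems.Splittings.LiIncrHighPart

end
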